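import Summits.QuantumFields.YangMills.Theorems.BalabanUVNodesN27AtRecordShadow
import Literature.MathematicalPhysics.QuantumFieldTheory.Balaban1983to89.T4DatumAssemblyTowerShadow

/-!
# BalabanUVNodes ∕ N27 = binder B5 AT THE RECORD, XVII — the SHADOW closer INSTANTIATED at dag-n23-a's tower ∕ shadow dictionary
# (`T4DatumAssemblyTowerShadow`, the module NODE 00's `Record9` consumes): B5 at a TOWER datum `datumOfTower F N (machineOfRecord₅ θ).toCore τ`
# ⟺ B5 at its Stage-5 SHADOW `Node00.datumOfRecord₅ F N θ` (same `C`, same `av`); hence `Spine` at the ₅C record predicate gives B5 at every world bound to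
# a tower datum — the shape of the ₉C instance (plan (W2′), chair R447; `Record9` not yet landed)
# (cell `pub-ymgap`, HUMAN RULING D-0062 Track A, seat `pub-ymgap-dag-n27-a` g4; `--supports stmt-QuantumFields-19182`, count-neutral)

WHY.  XVI showed that binder B5 reads the datum through `(C, av)` only (`b5_congr`) and gave the abstract shadow closer `spine_of_shadow`.  dag-n23-a's
`T4DatumAssemblyTowerShadow` (landed) is the dictionary NODE 00's Stage-9 record is built on: for admissible Stage-5 parameters `θ` and a tower `τ` over the
machine-of-record's core whose shadow operation IS `θ`'s residual `R` (`hR`), the tower datum and the shadow datum `Node00.datumOfRecord₅ F N θ` have the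
same construction (`datumOfRecord_C_eq_datumOfTower`) and — both being Stage-0 data of record — the same averaging maps (`rfl`), and every world bound to
the tower datum's construction with `θ`'s letters is a ₅C record at the shadow (`isRecordOfRecord₅C_shadow`).  THIS FILE applies XVI to it.

WHAT IS KERNEL-CHECKED ([bookkeeping]; 0 `def`, 0 `sorry`).
* §1 `b5_datumOfRecord₅_iff_datumOfTower` — B5 at the shadow datum ⟺ B5 at the tower datum (`b5_congr`; `C` by `datumOfRecord_C_eq_datumOfTower`, `av` by `rfl`).
* §2 **`b5_towerDatum_of_spine₅C`** — `Spine` at the ₅C record predicate ⇒ B5 at the tower datum, for every world bound to it with `θ`'s interval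
  constant, block size and C-binding (`isRecordOfRecord₅C_shadow` + §1).
* §3 **`spine_of_towerBound`** — for EVERY record predicate `Rec` whose pairs `(D, w)` are tower-bound in this sense (`D` a tower datum over an admissible
  `θ` with `hR`, `w` bound to it with `θ`'s letters), `Spine Rec₅C → Spine Rec` (XVI `spine_of_shadow`); the ₉C instance is ONE application once `Record9`
  exposes its pairs in this shape.

HONEST FRAMING.  Bookkeeping by name; B5 is NOT a theorem at ₅C (children 0∕1) — the premise `Spine Rec₅C` has no producer today; nothing of Bałaban's
asserted; NO node discharged; typed 28∕28, count untouched; one finite four-torus programme — NOT ℝ⁴, NOT infinite volume, NOT OS, NOT a mass gap, NOT Clay.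
Restate-immune.  No decl below carries a cite tag.
-/

namespace Summit.QuantumFields.YangMills.Theorems.BalabanUVNodesN27SpineRecord

open Literature.MathematicalPhysics.QuantumFieldTheory.Balaban1983to89
open Literature.MathematicalPhysics.QuantumFieldTheory.Balaban1983to89.T4Continuum
open Literature.MathematicalPhysics.QuantumFieldTheory.Balaban1983to89.T4DatumAssembly
open YMDAG.UVSplit

section Tower

variable (F : T4Family) (N : ℕ) [NeZero N]

/-! ## §1 B5 at the shadow datum ⟺ B5 at the tower datum -/

/-- **B5 AT THE STAGE-5 SHADOW ⟺ B5 AT THE TOWER DATUM.**  For Stage-5 parameters `θ` and a tower `τ` over the machine-of-record's core whose shadow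
operation is `θ`'s residual `R`: the two data have the same construction (`datumOfRecord_C_eq_datumOfTower`) and the same averaging maps (NODE 00's
`avOfRecord`, `rfl`), which is all binder B5 reads (XVI `b5_congr`). [bookkeeping] -/
theorem b5_datumOfRecord₅_iff_datumOfTower (θ : Node00.Stage5Params F N)
    (τ : (Node00.machineOfRecord₅ F N θ).toCore.Tower (Node00.avOfRecord F N))
    (hR : ∀ (p : B12.RunParams) (k : ℕ), θ.res.R p k = τ.shadowR p k) :
    T4ApexHybrid.HybridNE7Under (Node00.datumOfRecord₅ F N θ)
        (DagBinding.EndpointExistence (Node00.datumOfRecord₅ F N θ).C.toB12) ↔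
      T4ApexHybrid.HybridNE7Under (datumOfTower F N (Node00.machineOfRecord₅ F N θ).toCore τ)
        (DagBinding.EndpointExistence (datumOfTower F N (Node00.machineOfRecord₅ F N θ).toCore τ).C.toB12) :=
  b5_congr (D' := Node00.datumOfRecord₅ F N θ) (D := datumOfTower F N (Node00.machineOfRecord₅ F N θ).toCore τ)
    (datumOfRecord_C_eq_datumOfTower F N (Node00.machineOfRecord₅ F N θ) τ hR) rfl

/-! ## §2 `Spine` at ₅C ⇒ B5 at every world bound to a tower datum -/

/-- **B5 AT THE TOWER DATUM FROM `Spine` AT THE ₅C RECORD PREDICATE.**  If binder B5 holds at every ₅C record pair, then for admissible `θ`, a tower `τ`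
with `hR`, and ANY world `w` bound to the tower datum's construction with `θ`'s interval constant, Bałaban's block size and the C-binding of record at
`θ`, B5 holds at the tower datum — the pair `(shadow datum, w)` is a ₅C record (`isRecordOfRecord₅C_shadow`) and B5 transfers (§1). [bookkeeping] -/
theorem b5_towerDatum_of_spine₅C (h₅ : Spine (N := N) fun F D w => Node00.IsRecordOfRecord₅C F N D w)
    (θ : Node00.Stage5Params F N) (hθ : θ.Admissible)
    (τ : (Node00.machineOfRecord₅ F N θ).toCore.Tower (Node00.avOfRecord F N))
    (hR : ∀ (p : B12.RunParams) (k : ℕ), θ.res.R p k = τ.shadowR p k) (w : DagBinding.WorldP)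
    (hC : w.C = (datumOfTower F N (Node00.machineOfRecord₅ F N θ).toCore τ).C) (hγ : w.γ = θ.γ) (hL : w.L = (θ.L : ℝ))
    (hup : ∀ P : B12.RunParams, w.up P = Node00.upOfRecord₅C F N θ P) :
    T4ApexHybrid.HybridNE7Under (datumOfTower F N (Node00.machineOfRecord₅ F N θ).toCore τ)
      (DagBinding.EndpointExistence (datumOfTower F N (Node00.machineOfRecord₅ F N θ).toCore τ).C.toB12) :=
  (b5_datumOfRecord₅_iff_datumOfTower F N θ τ hR).mp (h₅ F _ w (isRecordOfRecord₅C_shadow F N θ hθ τ hR w hC hγ hL hup))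

/-! ## §3 The closer for every TOWER-BOUND record predicate (the ₉C shape) -/

/-- **`Spine Rec₅C → Spine Rec` FOR EVERY TOWER-BOUND RECORD PREDICATE.**  If every pair `(D, w)` of `Rec` (at rank `N`) is tower-bound — `D` is the tower
datum of an admissible `θ` and a tower `τ` with `θ`'s residual `R` as shadow operation, and `w` is bound to `D.C` with `θ`'s letters and C-binding — then
B5 at the ₅C record predicate gives B5 at `Rec` (XVI `spine_of_shadow` with the shadow `Node00.datumOfRecord₅ F N θ`).  Once `Node00/Record9` exposes its
pairs in this shape, `Spine Rec₉C` follows from `Spine Rec₅C` by ONE application. [bookkeeping] -/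
theorem spine_of_towerBound {Rec : RecordPred N}
    (hRec : ∀ (F : T4Family) (D : Datum F N) (w : DagBinding.WorldP), Rec F D w →
      ∃ (θ : Node00.Stage5Params F N) (_ : θ.Admissible)
        (τ : (Node00.machineOfRecord₅ F N θ).toCore.Tower (Node00.avOfRecord F N)),
        (∀ (p : B12.RunParams) (k : ℕ), θ.res.R p k = τ.shadowR p k) ∧
        D = datumOfTower F N (Node00.machineOfRecord₅ F N θ).toCore τ ∧
        w.C = D.C ∧ w.γ = θ.γ ∧ w.L = (θ.L : ℝ) ∧ (∀ P : B12.RunParams, w.up P = Node00.upOfRecord₅C F N θ P))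
    (h₅ : Spine (N := N) fun F D w => Node00.IsRecordOfRecord₅C F N D w) : Spine Rec := by
  refine spine_of_shadow (Rec' := fun F D w => Node00.IsRecordOfRecord₅C F N D w) (fun F D w hRDw => ?_) h₅
  obtain ⟨θ, hθ, τ, hR, rfl, hC, hγ, hL, hup⟩ := hRec F D w hRDw
  exact ⟨Node00.datumOfRecord₅ F N θ, isRecordOfRecord₅C_shadow F N θ hθ τ hR w hC hγ hL hup,
    datumOfRecord_C_eq_datumOfTower F N (Node00.machineOfRecord₅ F N θ) τ hR, rfl⟩

end Tower

end Summit.QuantumFields.YangMills.Theorems.BalabanUVNodesN27SpineRecord
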